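import Literature.AlgebraicGeometry.Resolution.PointBlowupFlagDropCaseOne
import HarnessLib

/-!
# Hauser–Perlega, Proposition 4 case (i) with both coordinate lines exceptional (`E_a = V(xy)`): rows relative to `x^{r_x} y^{r_y}`

H. Hauser, S. Perlega, *Resolving surface singularities in positive characteristic*, Publ. RIMS Kyoto Univ. **60**
(2024) 767–813 [cite: HauserPerlega2024], §4 p. 776 ("`F(x,y) = M(x,y)·G(x,y)`, where `M` is the unique monomial of maximal
degree supported on `E_a` that divides `F`"), §5 p. 783 (i) ("`F₁` equals a component of `F₂ ∩ E_a`": with `E_a = V(xy)` the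
case-(i) flags are `F₁ = V(z, y)` and `F₁ = V(z, x)` only) and Prop. 4 proof case (i) (p. 794 l. 22 – p. 795 l. 5:
"`M′(x,y) = x^{d_res−pᵉ}M(x,xy)` and `G′(x,y) = x^{−d_res}G(x,xy)`", for `M = x^{r_x}y^{r_y}`: `M′ = x^{r_x + r_y + d_res − pᵉ} y^{r_y}`).

## What is proved (sorry-free; any field `K`; NO new definition, NO named fact)

Series level, two letters, successor given by `x^q·C′ = C(x,xy)`, exceptional monomials `n = x^{r_x}y^{r_y}`,
`n′ = x^{r′_x}y^{r_y}` with `r′_x + q = r_x + r_y + d`, rows `R_i(x) = Σ_v [x^{r_x+v} y^{r_y+i}]C · x^v` (flag `F₁ = V(z,y)`,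
no shift):
* cancellation and exact division by a monomial (`monomial_mul_left_cancel`, `monomial_mul_divMonomial`), and
  **`x^d·G′ = G(x,xy)`** for `G = C/n`, `G′ = C′/n′` (`X_pow_mul_residual_eq_step_xy`);
* the order bound, a clean degree-`d` term, and the `y^d`-corner of the successor's rows (`rows_xy_degree_ge`,
  `rows_xy_exists_degree_eq`, `corner_ne_zero_of_step_xy`), **`s′ + d! = s`** (`inf_rows_step_add_factorial_xy`);
* the rows of a monomial `x^a y^b` (`inf_rows_monomial_xy`: `s_c = (c!/(c−b))·a` if `b < c`, `⊤` otherwise) and the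
  companion branch with `r_y`: **`min(s_c(M′^d), s_c(G′^{q−d})) + c! = min(s_c(M^d), s_c(G^{q−d}))`**
  (`companion_min_add_factorial_of_step_xy`).

## What is NOT proved here

Typed corollaries (atlas/game); `t ≠ 0`.

Provenance: seat res-D-pv-058 acting as res-L1-w43-stub-6 (cell res-hironaka, chain W4.3), 2026-08-27; a Literature
transcription of a PRINTED, refereed proposition in the tree's power-series model — not a statement about any
manuscript under adjudication.
-/

noncomputable section

open MvPolynomial Finset
open scoped BigOperators

namespace Literature.AlgebraicGeometry.Resolution

open Literature.AlgebraicGeometry.Resolution.Hauser2010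
open Literature.AlgebraicGeometry.Resolution.PointBlowup
open Literature.AlgebraicGeometry.Resolution.HauserWagner2014

namespace HauserPerlega2024

section ExceptionalY

variable {σ : Type*} {K : Type*} [Field K]

/-- the exponent `x^a y^b` evaluated at `x`. [folklore] -/
private theorem u_l {x y : σ} (hxy : x ≠ y) (a b : ℕ) : (Finsupp.single x a + Finsupp.single y b) x = a := by
  classical
  rw [Finsupp.add_apply, Finsupp.single_eq_same, Finsupp.single_apply, if_neg (Ne.symm hxy), add_zero]

/-- the exponent `x^a y^b` evaluated at `y`. [folklore] -/
private theorem u_r {x y : σ} (hxy : x ≠ y) (a b : ℕ) : (Finsupp.single x a + Finsupp.single y b) y = b := by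
  classical
  rw [Finsupp.add_apply, Finsupp.single_eq_same, Finsupp.single_apply, if_neg hxy, zero_add]

/-- two letters: an exponent is determined by its two entries. [folklore] -/
private theorem u_eq2 {x y : σ} (hσ : ∀ l, l = x ∨ l = y) {d d' : σ →₀ ℕ} (hx : d x = d' x) (hy : d y = d' y) :
    d = d' := by
  ext l
  rcases hσ l with rfl | rfl
  · exact hx
  · exact hy

/-- two letters: every exponent is `x^{d_x} y^{d_y}`. [folklore] -/
private theorem u_ssa {x y : σ} (hxy : x ≠ y) (hσ : ∀ l, l = x ∨ l = y) (d : σ →₀ ℕ) :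
    d = Finsupp.single x (d x) + Finsupp.single y (d y) :=
  u_eq2 hσ (u_l hxy _ _).symm (u_r hxy _ _).symm

/-- two letters: comparison of exponents. [folklore] -/
private theorem u_le2 {x y : σ} (hσ : ∀ l, l = x ∨ l = y) {f g : σ →₀ ℕ} : f ≤ g ↔ f x ≤ g x ∧ f y ≤ g y := by
  refine ⟨fun h => ⟨h x, h y⟩, fun h l => ?_⟩
  rcases hσ l with rfl | rfl
  · exact h.1
  · exact h.2

/-- two letters: a sum over all letters has two terms. [folklore] -/
private theorem u_sum2 {M : Type*} [AddCommMonoid M] [Fintype σ] {x y : σ} (hxy : x ≠ y)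
    (hσ : ∀ l, l = x ∨ l = y) (f : σ → M) : ∑ l, f l = f x + f y := by
  classical
  have huniv : (Finset.univ : Finset σ) = {x, y} := by
    ext l
    simp only [Finset.mem_univ, Finset.mem_insert, Finset.mem_singleton, true_iff]
    exact hσ l
  rw [huniv, Finset.sum_pair hxy]

/-- unfolding the division by a monomial. [folklore] -/
private theorem coeff_divMonomial₃ (m d : σ →₀ ℕ) (H : MvPowerSeries σ K) :
    MvPowerSeries.coeff d (divMonomial m H) = MvPowerSeries.coeff (d + m) H := rfl

/-- **cancellation of a monomial**: `n·A = n·B ⇒ A = B` for the monomial `n` with coefficient `1` — the division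
"`G′(x,y) = x^{−d_res}G(x,xy)`" by the exceptional monomial `M′` is well defined. [cite: HauserPerlega2024, Prop. 4 proof case (i) p. 794 l. 38–40] -/
theorem monomial_mul_left_cancel (n : σ →₀ ℕ) {A B : MvPowerSeries σ K}
    (h : MvPowerSeries.monomial n (1 : K) * A = MvPowerSeries.monomial n (1 : K) * B) : A = B := by
  classical
  ext m
  have key : ∀ D : MvPowerSeries σ K,
      MvPowerSeries.coeff (m + n) (MvPowerSeries.monomial n (1 : K) * D) = MvPowerSeries.coeff m D := fun D => by
    rw [MvPowerSeries.coeff_monomial_mul, if_pos le_add_self, one_mul, add_tsub_cancel_right]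
  have h1 := congrArg (MvPowerSeries.coeff (m + n)) h
  rw [key, key] at h1
  exact h1

/-- **`M·(C/M) = C`** when the monomial `M` divides `C` (every exponent of `C` dominates that of `M`). [cite: HauserPerlega2024, §4 p. 776 (F = M·G)] -/
theorem monomial_mul_divMonomial (n : σ →₀ ℕ) (C : MvPowerSeries σ K) (hn : ∀ m, MvPowerSeries.coeff m C ≠ 0 → n ≤ m) :
    MvPowerSeries.monomial n (1 : K) * divMonomial n C = C := by
  classical
  ext m
  rw [MvPowerSeries.coeff_monomial_mul]
  split_ifs with hle
  · rw [one_mul, coeff_divMonomial₃, tsub_add_cancel_of_le hle]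
  · by_contra hne
    exact hle (hn m (Ne.symm hne))

variable [Fintype σ] [DecidableEq σ]

/-- **"`M′(x,y) = x^{d_res−pᵉ}M(x,xy)` and `G′(x,y) = x^{−d_res}G(x,xy)`" for `M = x^{r_x}y^{r_y}`**: from `x^q·C′ = C(x,xy)`,
`M ∣ C`, `M′ = x^{r′_x}y^{r_y} ∣ C′` and `r′_x + q = r_x + r_y + d`, the residual factors satisfy `x^d·G′ = G(x,xy)`.
[cite: HauserPerlega2024, Prop. 4 proof case (i) p. 794 l. 36–40] -/
theorem X_pow_mul_residual_eq_step_xy (q : ℕ) (x y : σ) (hxy : x ≠ y) (C C' : MvPowerSeries σ K)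
    (hC' : (MvPowerSeries.X x : MvPowerSeries σ K) ^ q * C' = MvPowerSeries.subst (fun l => if l = y then (MvPowerSeries.X x : MvPowerSeries σ K) * MvPowerSeries.X y
        else MvPowerSeries.X l) C)
    (rx rx' ry d : ℕ) (hr' : rx' + q = rx + ry + d)
    (hn : ∀ m, MvPowerSeries.coeff m C ≠ 0 → Finsupp.single x rx + Finsupp.single y ry ≤ m)
    (hn' : ∀ m, MvPowerSeries.coeff m C' ≠ 0 → Finsupp.single x rx' + Finsupp.single y ry ≤ m) :
    (MvPowerSeries.X x : MvPowerSeries σ K) ^ d * divMonomial (Finsupp.single x rx' + Finsupp.single y ry) C' =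
      MvPowerSeries.subst (fun l => if l = y then (MvPowerSeries.X x : MvPowerSeries σ K) * MvPowerSeries.X y
        else MvPowerSeries.X l) (divMonomial (Finsupp.single x rx + Finsupp.single y ry) C) := by
  have hst := hasSubst_step (K := K) x y
  set G := divMonomial (Finsupp.single x rx + Finsupp.single y ry) C with hG
  set G' := divMonomial (Finsupp.single x rx' + Finsupp.single y ry) C' with hG'
  have hC : C = (MvPowerSeries.X x : MvPowerSeries σ K) ^ rx * (MvPowerSeries.X y) ^ ry * G := by
    rw [MvPowerSeries.X_pow_eq, MvPowerSeries.X_pow_eq, MvPowerSeries.monomial_mul_monomial, one_mul,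
      monomial_mul_divMonomial _ C hn]
  have hC'' : C' = (MvPowerSeries.X x : MvPowerSeries σ K) ^ rx' * (MvPowerSeries.X y) ^ ry * G' := by
    rw [MvPowerSeries.X_pow_eq, MvPowerSeries.X_pow_eq, MvPowerSeries.monomial_mul_monomial, one_mul,
      monomial_mul_divMonomial _ C' hn']
  -- `x^{r_x+r_y} y^{r_y} · (x^d G′) = x^{r_x+r_y} y^{r_y} · G(x,xy)`
  apply monomial_mul_left_cancel (Finsupp.single x (rx + ry) + Finsupp.single y ry)
  have hM : MvPowerSeries.monomial (Finsupp.single x (rx + ry) + Finsupp.single y ry) (1 : K) =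
      (MvPowerSeries.X x : MvPowerSeries σ K) ^ (rx + ry) * MvPowerSeries.X y ^ ry := by
    rw [MvPowerSeries.X_pow_eq, MvPowerSeries.X_pow_eq, MvPowerSeries.monomial_mul_monomial, one_mul]
  rw [hM]
  have lhs : (MvPowerSeries.X x : MvPowerSeries σ K) ^ (rx + ry) * MvPowerSeries.X y ^ ry *
      ((MvPowerSeries.X x : MvPowerSeries σ K) ^ d * G') = (MvPowerSeries.X x : MvPowerSeries σ K) ^ q * C' := by
    rw [hC'']
    have : rx + ry + d = q + rx' := by omega
    calc (MvPowerSeries.X x : MvPowerSeries σ K) ^ (rx + ry) * MvPowerSeries.X y ^ ry * (MvPowerSeries.X x ^ d * G')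
        = (MvPowerSeries.X x : MvPowerSeries σ K) ^ (rx + ry + d) * (MvPowerSeries.X y ^ ry * G') := by ring
      _ = (MvPowerSeries.X x : MvPowerSeries σ K) ^ (q + rx') * (MvPowerSeries.X y ^ ry * G') := by rw [this]
      _ = _ := by ring
  have rhs : (MvPowerSeries.X x : MvPowerSeries σ K) ^ (rx + ry) * MvPowerSeries.X y ^ ry * MvPowerSeries.subst (fun l => if l = y then (MvPowerSeries.X x : MvPowerSeries σ K) * MvPowerSeries.X y
        else MvPowerSeries.X l) G =
      MvPowerSeries.subst (fun l => if l = y then (MvPowerSeries.X x : MvPowerSeries σ K) * MvPowerSeries.X y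
        else MvPowerSeries.X l) C := by
    rw [hC, MvPowerSeries.subst_mul hst, MvPowerSeries.subst_mul hst, MvPowerSeries.subst_pow hst,
      MvPowerSeries.subst_pow hst, MvPowerSeries.subst_X hst, MvPowerSeries.subst_X hst, if_neg hxy, if_pos rfl]
    ring
  rw [lhs, rhs, hC']

omit [Fintype σ] [DecidableEq σ] in
/-- **the order bound on the rows relative to `x^{r_x}y^{r_y}`**: if every monomial of `C` has degree `≥ r_x + r_y + d` then
row `i` vanishes below degree `d − i`. [cite: HauserPerlega2024, §4 p. 776 (d_res = ord G)] -/
theorem rows_xy_degree_ge (x y : σ) (hxy : x ≠ y) (C : MvPowerSeries σ K) (rx ry d : ℕ)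
    (hmin : ∀ m, MvPowerSeries.coeff m C ≠ 0 → rx + ry + d ≤ m x + m y) (R : ℕ → PowerSeries K)
    (hR : ∀ j v, PowerSeries.coeff v (R j) =
      MvPowerSeries.coeff (Finsupp.single x (rx + v) + Finsupp.single y (ry + j)) C) :
    ∀ i a, PowerSeries.coeff a (R i) ≠ 0 → d ≤ i + a := by
  intro i a h
  rw [hR] at h
  have := hmin _ h
  rw [u_l hxy, u_r hxy] at this
  omega

omit [Fintype σ] [DecidableEq σ] in
/-- **a clean term of degree `d` in the rows** (no shift): a monomial of `C` of degree exactly `r_x + r_y + d` lies in row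
`i` at degree `a` with `i + a = d`. [cite: HauserPerlega2024, §4 p. 776 (ord G = d_res)] -/
theorem rows_xy_exists_degree_eq (x y : σ) (hxy : x ≠ y) (hσ : ∀ l, l = x ∨ l = y) (C : MvPowerSeries σ K)
    (rx ry d : ℕ) (hn : ∀ m, MvPowerSeries.coeff m C ≠ 0 → Finsupp.single x rx + Finsupp.single y ry ≤ m)
    (hex : ∃ m, MvPowerSeries.coeff m C ≠ 0 ∧ m x + m y = rx + ry + d) (R : ℕ → PowerSeries K)
    (hR : ∀ j v, PowerSeries.coeff v (R j) =
      MvPowerSeries.coeff (Finsupp.single x (rx + v) + Finsupp.single y (ry + j)) C) :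
    ∃ i a, PowerSeries.coeff a (R i) ≠ 0 ∧ i + a = d := by
  obtain ⟨m, hm, hdeg⟩ := hex
  have hle := (u_le2 hσ).mp (hn m hm)
  rw [u_l hxy, u_r hxy] at hle
  refine ⟨m y - ry, m x - rx, ?_, by omega⟩
  rw [hR, show rx + (m x - rx) = m x by omega, show ry + (m y - ry) = m y by omega, ← u_ssa hxy hσ m]
  exact hm

/-- **the `y^d`-corner of the successor** (`E_a = V(xy)`, flag `F₁ = V(z,y)`): under `x^q·C′ = C(x,xy)` with the row data above
and `d′ = d`, row `d` of `C′/(x^{r′_x}y^{r_y})` has a non-zero constant term ("`c_{d_res} ≠ 0`").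
[cite: HauserPerlega2024, Prop. 4 proof case (i) p. 794 l. 36–45] -/
theorem corner_ne_zero_of_step_xy (q : ℕ) (x y : σ) (hxy : x ≠ y) (hσ : ∀ l, l = x ∨ l = y) (C C' : MvPowerSeries σ K)
    (hC' : (MvPowerSeries.X x : MvPowerSeries σ K) ^ q * C' = MvPowerSeries.subst (fun l => if l = y then (MvPowerSeries.X x : MvPowerSeries σ K) * MvPowerSeries.X y
        else MvPowerSeries.X l) C)
    (rx rx' ry d : ℕ) (hr' : rx' + q = rx + ry + d)
    (hn : ∀ m, MvPowerSeries.coeff m C ≠ 0 → Finsupp.single x rx + Finsupp.single y ry ≤ m)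
    (hex : ∃ m, MvPowerSeries.coeff m C ≠ 0 ∧ m x + m y = rx + ry + d)
    (hmin' : ∀ m, MvPowerSeries.coeff m C' ≠ 0 → rx' + ry + d ≤ m x + m y) (R R' : ℕ → PowerSeries K)
    (hR : ∀ j v, PowerSeries.coeff v (R j) =
      MvPowerSeries.coeff (Finsupp.single x (rx + v) + Finsupp.single y (ry + j)) C)
    (hR' : ∀ j v, PowerSeries.coeff v (R' j) =
      MvPowerSeries.coeff (Finsupp.single x (rx' + v) + Finsupp.single y (ry + j)) C') :
    PowerSeries.coeff 0 (R' d) ≠ 0 := by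
  obtain ⟨i, a, hia, hsum⟩ := rows_xy_exists_degree_eq x y hxy hσ C rx ry d hn hex R hR
  have hstep := coeff_step_row_xy q x y hxy hσ C C' hC' rx rx' ry d hr' R R' hR hR' i 0 (by omega)
  rw [zero_add, show d - i = a by omega] at hstep
  have hne : PowerSeries.coeff 0 (R' i) ≠ 0 := by rw [hstep]; exact hia
  have hid : d ≤ i := by
    have := rows_xy_degree_ge x y hxy C' rx' ry d hmin' R' hR' i 0 hne
    omega
  have : i = d := by omega
  rw [this] at hne
  exact hne

/-- **[HP24, Prop. 4 case (i)] with `E_a = V(xy)`, flag `F₁ = V(z,y)`: `s′ + d! = s`** for the rows relative to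
`x^{r_x}y^{r_y}` and `x^{r′_x}y^{r_y}`. [cite: HauserPerlega2024, Prop. 4 proof case (i) p. 794 l. 22 – p. 795 l. 5] -/
theorem inf_rows_step_add_factorial_xy (q : ℕ) (x y : σ) (hxy : x ≠ y) (hσ : ∀ l, l = x ∨ l = y)
    (C C' : MvPowerSeries σ K)
    (hC' : (MvPowerSeries.X x : MvPowerSeries σ K) ^ q * C' = MvPowerSeries.subst (fun l => if l = y then (MvPowerSeries.X x : MvPowerSeries σ K) * MvPowerSeries.X y
        else MvPowerSeries.X l) C)
    (rx rx' ry d : ℕ) (hr' : rx' + q = rx + ry + d)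
    (hmin : ∀ m, MvPowerSeries.coeff m C ≠ 0 → rx + ry + d ≤ m x + m y) (R R' : ℕ → PowerSeries K)
    (hR : ∀ j v, PowerSeries.coeff v (R j) =
      MvPowerSeries.coeff (Finsupp.single x (rx + v) + Finsupp.single y (ry + j)) C)
    (hR' : ∀ j v, PowerSeries.coeff v (R' j) =
      MvPowerSeries.coeff (Finsupp.single x (rx' + v) + Finsupp.single y (ry + j)) C') :
    (Finset.range d).inf (fun i => ((d.factorial / (d - i) : ℕ) : ℕ∞) * (R' i).order) + (d.factorial : ℕ∞) =
      (Finset.range d).inf (fun i => ((d.factorial / (d - i) : ℕ) : ℕ∞) * (R i).order) :=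
  inf_rows_add_factorial_eq_of_step R R' (fun i hi a => coeff_step_row_xy q x y hxy hσ C C' hC' rx rx' ry d hr' R R' hR hR' i a
    hi.le) (rows_xy_degree_ge x y hxy C rx ry d hmin R hR)

omit [Fintype σ] [DecidableEq σ] in
/-- **the rows of a monomial `x^a y^b`**: `s_c(x^a y^b) = (c!/(c−b))·a` if `b < c`, and `⊤` otherwise (the only non-zero row is
row `b`, of order `a`). [cite: HauserPerlega2024, §5 p. 783 (coeff^c of the monomial generator M^d)] -/
theorem inf_rows_monomial_xy (c a b : ℕ) (x y : σ) (hxy : x ≠ y) (R : ℕ → PowerSeries K)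
    (hR : ∀ j v, PowerSeries.coeff v (R j) = MvPowerSeries.coeff (Finsupp.single x v + Finsupp.single y j)
      (MvPowerSeries.monomial (Finsupp.single x a + Finsupp.single y b) (1 : K))) :
    (Finset.range c).inf (fun i => ((c.factorial / (c - i) : ℕ) : ℕ∞) * (R i).order) =
      if b < c then (((c.factorial / (c - b) * a : ℕ) : ℕ∞)) else ⊤ := by
  classical
  have hRb : R b = PowerSeries.monomial a (1 : K) := by
    ext v
    rw [hR, PowerSeries.coeff_monomial, MvPowerSeries.coeff_monomial]
    have : (Finsupp.single x v + Finsupp.single y b = Finsupp.single x a + Finsupp.single y b) ↔ v = a := by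
      constructor
      · intro h; have := congrArg (fun f : σ →₀ ℕ => f x) h; simpa [u_l hxy] using this
      · intro h; rw [h]
    simp only [this]
  have hRj : ∀ j, j ≠ b → R j = 0 := by
    intro j hj
    ext v
    rw [hR, MvPowerSeries.coeff_monomial, map_zero, if_neg]
    intro h
    have := congrArg (fun f : σ →₀ ℕ => f y) h
    simp only [u_r hxy] at this
    exact hj this
  have hcpos : ∀ i, i < c → (c.factorial / (c - i) : ℕ) ≠ 0 := fun i hi =>
    (Nat.div_pos (le_trans (Nat.sub_le c i) (Nat.self_le_factorial c)) (by omega)).ne'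
  split_ifs with hbc
  · apply le_antisymm
    · calc (Finset.range c).inf (fun i => ((c.factorial / (c - i) : ℕ) : ℕ∞) * (R i).order)
          ≤ ((c.factorial / (c - b) : ℕ) : ℕ∞) * (R b).order := Finset.inf_le (Finset.mem_range.mpr hbc)
        _ = ((c.factorial / (c - b) * a : ℕ) : ℕ∞) := by
            rw [hRb, PowerSeries.order_monomial_of_ne_zero a (1 : K) one_ne_zero, Nat.cast_mul]
    · refine Finset.le_inf fun i hi => ?_
      rw [Finset.mem_range] at hi
      by_cases hib : i = b
      · subst hib
        rw [hRb, PowerSeries.order_monomial_of_ne_zero a (1 : K) one_ne_zero, Nat.cast_mul]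
      · rw [hRj i hib, PowerSeries.order_zero, ENat.mul_top (by exact_mod_cast hcpos i hi)]
        exact le_top
  · refine top_le_iff.mp (Finset.le_inf fun i hi => ?_)
    rw [Finset.mem_range] at hi
    rw [hRj i (by omega), PowerSeries.order_zero, ENat.mul_top (by exact_mod_cast hcpos i hi)]

/-- **the monomial part with `r_y`**: `(c!/(c − d·r_y))·(d·r′_x) + c! = (c!/(c − d·r_y))·(d·r_x)` for `c = (q−d)d`, `d < q`,
`r′_x + q = r_x + r_y + d`, `d·r_y < c` ("`M′^{d} = x^{d r′_x} y^{d r_y}`" against "`M^d = x^{d r_x} y^{d r_y}`": the drop is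
exactly `c!`). [cite: HauserPerlega2024, Prop. 4 proof case (i) p. 795 l. 1–5] -/
theorem companion_monomial_add_factorial_xy {q d rx rx' ry : ℕ} (hdq : d < q) (hr' : rx' + q = rx + ry + d)
    (hry : d * ry < (q - d) * d) :
    ((((q - d) * d).factorial / ((q - d) * d - d * ry) * (d * rx') : ℕ) : ℕ∞) + ((((q - d) * d).factorial : ℕ) : ℕ∞) =
      ((((q - d) * d).factorial / ((q - d) * d - d * ry) * (d * rx) : ℕ) : ℕ∞) := by
  rw [← Nat.cast_add, Nat.cast_inj]
  have hc1 : 1 ≤ (q - d) * d - d * ry := by omega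
  have hdiv : ((q - d) * d).factorial / ((q - d) * d - d * ry) * ((q - d) * d - d * ry) = ((q - d) * d).factorial :=
    Nat.div_mul_cancel (Nat.dvd_factorial hc1 (Nat.sub_le _ _))
  have hr : d * rx = d * rx' + ((q - d) * d - d * ry) := by
    have h1 : d * ry ≤ (q - d) * d := hry.le
    have h2 : d ≤ q := hdq.le
    zify [h1, h2]
    have : (rx : ℤ) = rx' + q - ry - d := by omega
    rw [this]
    ring
  rw [hr, mul_add, hdiv]

/-- **[HP24, Prop. 4 case (i)], companion branch, with `E_a = V(xy)`** (flag `F₁ = V(z,y)`): with `n = x^{r_x}y^{r_y} ∣ C`,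
`n′ = x^{r′_x}y^{r_y} ∣ C′`, `x^q·C′ = C(x,xy)`, `r′_x + q = r_x + r_y + d`, `d < q`, `c = (q−d)d`, all monomials of `C` of
degree `≥ r_x + r_y + d`; `G = C/n`, `G′ = C′/n′`, `M = n`, `M′ = n′`:
`min(s_c(M′^d), s_c(G′^{q−d})) + c! = min(s_c(M^d), s_c(G^{q−d}))`.
[cite: HauserPerlega2024, Prop. 4 proof case (i) p. 794 l. 36 – p. 795 l. 5] -/
theorem companion_min_add_factorial_of_step_xy (q : ℕ) (x y : σ) (hxy : x ≠ y) (hσ : ∀ l, l = x ∨ l = y)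
    (C C' : MvPowerSeries σ K)
    (hC' : (MvPowerSeries.X x : MvPowerSeries σ K) ^ q * C' = MvPowerSeries.subst (fun l => if l = y then (MvPowerSeries.X x : MvPowerSeries σ K) * MvPowerSeries.X y
        else MvPowerSeries.X l) C)
    (rx rx' ry d : ℕ) (hdq : d < q) (hr' : rx' + q = rx + ry + d)
    (hn : ∀ m, MvPowerSeries.coeff m C ≠ 0 → Finsupp.single x rx + Finsupp.single y ry ≤ m)
    (hn' : ∀ m, MvPowerSeries.coeff m C' ≠ 0 → Finsupp.single x rx' + Finsupp.single y ry ≤ m)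
    (hmin : ∀ m, MvPowerSeries.coeff m C ≠ 0 → rx + ry + d ≤ m x + m y)
    (RM RM' RG RG' : ℕ → PowerSeries K)
    (hRM : ∀ j v, PowerSeries.coeff v (RM j) = MvPowerSeries.coeff (Finsupp.single x v + Finsupp.single y j)
      ((MvPowerSeries.monomial (Finsupp.single x rx + Finsupp.single y ry) (1 : K)) ^ d))
    (hRM' : ∀ j v, PowerSeries.coeff v (RM' j) = MvPowerSeries.coeff (Finsupp.single x v + Finsupp.single y j)
      ((MvPowerSeries.monomial (Finsupp.single x rx' + Finsupp.single y ry) (1 : K)) ^ d))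
    (hRG : ∀ j v, PowerSeries.coeff v (RG j) = MvPowerSeries.coeff (Finsupp.single x v + Finsupp.single y j)
      ((divMonomial (Finsupp.single x rx + Finsupp.single y ry) C) ^ (q - d)))
    (hRG' : ∀ j v, PowerSeries.coeff v (RG' j) = MvPowerSeries.coeff (Finsupp.single x v + Finsupp.single y j)
      ((divMonomial (Finsupp.single x rx' + Finsupp.single y ry) C') ^ (q - d))) :
    min ((Finset.range ((q - d) * d)).inf (fun i => ((((q - d) * d).factorial / ((q - d) * d - i) : ℕ) : ℕ∞) * (RM' i).order))
        ((Finset.range ((q - d) * d)).inf (fun i => ((((q - d) * d).factorial / ((q - d) * d - i) : ℕ) : ℕ∞) * (RG' i).order)) +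
        ((((q - d) * d).factorial : ℕ) : ℕ∞) =
      min ((Finset.range ((q - d) * d)).inf (fun i => ((((q - d) * d).factorial / ((q - d) * d - i) : ℕ) : ℕ∞) * (RM i).order))
        ((Finset.range ((q - d) * d)).inf (fun i => ((((q - d) * d).factorial / ((q - d) * d - i) : ℕ) : ℕ∞) * (RG i).order)) := by
  classical
  set c := (q - d) * d with hc
  -- the monomial parts
  have hMd : (MvPowerSeries.monomial (Finsupp.single x rx + Finsupp.single y ry) (1 : K)) ^ d =
      MvPowerSeries.monomial (Finsupp.single x (d * rx) + Finsupp.single y (d * ry)) 1 := by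
    rw [MvPowerSeries.monomial_pow, one_pow, smul_add, Finsupp.smul_single, Finsupp.smul_single, smul_eq_mul, smul_eq_mul]
  have hMd' : (MvPowerSeries.monomial (Finsupp.single x rx' + Finsupp.single y ry) (1 : K)) ^ d =
      MvPowerSeries.monomial (Finsupp.single x (d * rx') + Finsupp.single y (d * ry)) 1 := by
    rw [MvPowerSeries.monomial_pow, one_pow, smul_add, Finsupp.smul_single, Finsupp.smul_single, smul_eq_mul, smul_eq_mul]
  have hM := inf_rows_monomial_xy c (d * rx) (d * ry) x y hxy RM (fun j v => by rw [hRM, hMd])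
  have hM' := inf_rows_monomial_xy c (d * rx') (d * ry) x y hxy RM' (fun j v => by rw [hRM', hMd'])
  -- the residual parts
  have hG := X_pow_mul_residual_eq_step_xy q x y hxy C C' hC' rx rx' ry d hr' hn hn'
  have hGk := X_pow_mul_pow_eq_step_pow x y _ _ d (q - d) hG
  rw [show d * (q - d) = c by rw [hc, mul_comm]] at hGk
  have hminG : ∀ m, MvPowerSeries.coeff m ((divMonomial (Finsupp.single x rx + Finsupp.single y ry) C) ^ (q - d)) ≠ 0 →
      c ≤ m x + m y := by
    intro m hm
    have h1 : ((d : ℕ) : ℕ∞) ≤ (divMonomial (Finsupp.single x rx + Finsupp.single y ry) C).order := by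
      refine MvPowerSeries.nat_le_order fun n' hn'' => ?_
      by_contra hne
      rw [coeff_divMonomial₃] at hne
      have h2 := hmin _ hne
      have ex : (n' + (Finsupp.single x rx + Finsupp.single y ry)) x = n' x + rx := by rw [Finsupp.add_apply, u_l hxy]
      have ey : (n' + (Finsupp.single x rx + Finsupp.single y ry)) y = n' y + ry := by rw [Finsupp.add_apply, u_r hxy]
      rw [ex, ey] at h2
      rw [Finsupp.degree_eq_sum, u_sum2 hxy hσ] at hn''
      have : (n' x + n' y : ℕ) < d := by exact_mod_cast hn''
      omega
    have h3 := le_trans (le_trans (nsmul_le_nsmul_right h1 (q - d))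
      (MvPowerSeries.le_order_pow (f := divMonomial (Finsupp.single x rx + Finsupp.single y ry) C) (q - d)))
      (MvPowerSeries.order_le hm)
    rw [Finsupp.degree_eq_sum, u_sum2 hxy hσ, nsmul_eq_mul, ← Nat.cast_mul, Nat.cast_le] at h3
    rw [hc]
    exact h3
  have hGrows := inf_rows_add_factorial_of_step' c x y hxy hσ _ _ hGk hminG RG RG' hRG hRG'
  -- assemble
  rw [← min_add_add_right, hGrows, hM', hM]
  by_cases hry : d * ry < c
  · rw [if_pos hry, if_pos hry, hc, companion_monomial_add_factorial_xy hdq hr' (by rw [← hc]; exact hry)]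
  · rw [if_neg hry, if_neg hry, top_add]

end ExceptionalY

end HauserPerlega2024

end Literature.AlgebraicGeometry.Resolution
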